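import Literature.Analysis.InverseSpectral.StieltjesApproximation
import Literature.Analysis.InverseSpectral.KreinStringRational
import Literature.Analysis.InverseSpectral.KreinStringCompactness
import Literature.Analysis.InverseSpectral.KreinStringOfProfile
import Literature.Analysis.InverseSpectral.KreinStringWeylContinuity
import Literature.Analysis.InverseSpectral.StieltjesHolomorphic
import Literature.Analysis.InverseSpectral.KreinStringWeylAnalytic
import Literature.Analysis.InverseSpectral.KreinStringSpectral
import HarnessLib

/-!
# Kreĭn's inverse spectral theorem: existence

**Conjunct (iii) of `KreinInverseSpectralTheorem`**: every function of class `N_S` not vanishing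
identically is the principal Titchmarsh–Weyl function of a Kreĭn string other than the free
half-line (`krein_existence`). The proof is the approximation argument of Kac–Kreĭn (1974, §11) /
Kotani–Watanabe (1982, §2):

1. discretise the Stieltjes data to rational Stieltjes functions `q_n → q`
   (`StieltjesApproximation`);
2. realise each `q_n` by a Stieltjes string `T_n` (Stieltjes' algorithm, `KreinStringRational`);
3. extract a subsequence whose mass profiles converge (Helly, `KreinStringCompactness`), discard
   the degenerate limits (`KreinStringContinuity`: they would force `q_n(-1) → 0` or `→ ∞`), and
   build the limit string `S` (`KreinStringOfProfile`);
4. the continuity theorem on the negative axis (`KreinStringWeylContinuity`) gives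
   `q_S(-s) = lim q_{T_n}(-s) = q(-s)`, and the identity principle on `ℂ ∖ [0, ∞)`
   (`StieltjesHolomorphic`) gives `q_S = q`.

## References

KacKrein1974 (§11), KotaniWatanabe1982 (§2), Kasahara1975, DymMcKean1976 (§§5–6).
-/

open MeasureTheory Filter Set Topology
open scoped ENNReal

noncomputable section

namespace Literature.Analysis.InverseSpectral

/-! ### Values on the negative axis -/

/-- **A nonzero Stieltjes function is positive on the negative axis**: `q(-s) > 0` is real for
`s > 0`. [cite: KacKrein1974, Supplement I] -/
theorem re_apply_neg_pos_of_hasStieltjesRepresentation {q : ℂ → ℂ} {b : ℝ} {σ : Measure ℝ}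
    (h : HasStieltjesRepresentation q b σ) (hne : ∃ z ∈ offNonnegAxis, q z ≠ 0) {s : ℝ}
    (hs : 0 < s) : 0 < (q (-(s : ℂ))).re ∧ (q (-(s : ℂ))).im = 0 := by
  have hz : (-(s : ℂ)) ∈ offNonnegAxis := Or.inr (by simpa using hs)
  have hae : ∀ᵐ t ∂σ, (0 : ℝ) ≤ t := by
    rw [ae_iff]
    have hset : {a : ℝ | ¬0 ≤ a} = Iio 0 := by ext a; simp
    rw [hset]; exact h.2.1
  have hint := integrable_inv_one_add_of_hasStieltjesRepresentation h
  -- the kernel at `-s` is the real function `(t + s)⁻¹`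
  have hker : ∀ t : ℝ, ((t : ℂ) - (-(s : ℂ)))⁻¹ = (((t + s)⁻¹ : ℝ) : ℂ) := fun t => by
    push_cast; ring
  have hreal : q (-(s : ℂ)) = ((b + ∫ t, (t + s)⁻¹ ∂σ : ℝ) : ℂ) := by
    rw [h.2.2.2 _ hz]
    simp_rw [hker]
    rw [integral_complex_ofReal]
    push_cast
    ring
  -- integrability of the real kernel
  have hki : Integrable (fun t : ℝ => (t + s)⁻¹) σ := by
    refine Integrable.mono' (hint.const_mul (max 1 s⁻¹)) (by fun_prop) ?_
    filter_upwards [hae] with t ht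
    rw [Real.norm_eq_abs, abs_of_nonneg (by positivity)]
    -- `(t+s)⁻¹ ≤ max(1, 1/s) (1+t)⁻¹`
    rw [← div_eq_mul_inv, le_div_iff₀ (by linarith), ← sub_nonneg]
    have hm1 : 1 ≤ max 1 s⁻¹ := le_max_left _ _
    have hm2 : s⁻¹ ≤ max 1 s⁻¹ := le_max_right _ _
    have hts : 0 < t + s := by linarith
    have : (t + s)⁻¹ * (1 + t) ≤ max 1 s⁻¹ := by
      rw [inv_mul_le_iff₀ hts]
      have h1 : 1 ≤ max 1 s⁻¹ * s := by
        calc (1 : ℝ) = s⁻¹ * s := by field_simp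
          _ ≤ max 1 s⁻¹ * s := mul_le_mul_of_nonneg_right hm2 hs.le
      nlinarith
    linarith
  refine ⟨?_, by rw [hreal, Complex.ofReal_im]⟩
  rw [hreal, Complex.ofReal_re]
  -- positivity: if `b + ∫ = 0` then `b = 0` and `σ = 0`, so `q ≡ 0`
  have hI0 : 0 ≤ ∫ t, (t + s)⁻¹ ∂σ :=
    integral_nonneg_of_ae (hae.mono fun t ht => by positivity)
  by_contra hle
  have hsum : b + ∫ t, (t + s)⁻¹ ∂σ = 0 := le_antisymm (not_lt.1 hle) (add_nonneg h.1 hI0)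
  have hb0 : b = 0 := by linarith [h.1]
  have hI : ∫ t, (t + s)⁻¹ ∂σ = 0 := by linarith
  have hσ0 : σ = 0 := by
    rw [integral_eq_zero_iff_of_nonneg_ae (hae.mono fun t ht => by positivity) hki] at hI
    -- `(t+s)⁻¹ = 0` a.e. is impossible on `[0,∞)` unless `σ = 0`
    have : ∀ᵐ t ∂σ, False := by
      filter_upwards [hI, hae] with t ht ht0
      have : (0 : ℝ) < (t + s)⁻¹ := by positivity
      simp only [Pi.zero_apply] at ht
      linarith
    exact Measure.measure_univ_eq_zero.1 (by simpa using (ae_iff.1 this))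
  obtain ⟨z, hzU, hqz⟩ := hne
  apply hqz
  rw [h.2.2.2 z hzU, hb0, hσ0]
  simp

/-! ### Step 2: strings for the discretised data -/

/-- **Each discretised Stieltjes function is the Titchmarsh–Weyl function of a Stieltjes
string** (unless it vanishes identically). [cite: KacKrein1974, §11] -/
theorem exists_string_of_discretised {q : ℂ → ℂ} {b : ℝ} {σ : Measure ℝ}
    (h : HasStieltjesRepresentation q b σ) {n : ℕ} (hn : 0 < n)
    (hne : ∃ z ∈ offNonnegAxis,
      (b : ℂ) + ∫ t : ℝ, ((t : ℂ) - z)⁻¹ ∂(discretisedMeasure σ n) ≠ 0) :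
    ∃ T : KreinString, ¬ T.IsTrivial ∧ EqOn T.principalWeylFunction
      (fun z => (b : ℂ) + ∫ t : ℝ, ((t : ℂ) - z)⁻¹ ∂(discretisedMeasure σ n)) offNonnegAxis := by
  classical
  haveI := isFiniteMeasure_discretisedMeasure h n
  have hd := hasStieltjesRepresentation_discretised h n
  set A := (Finset.range (n * n)).image (fun k : ℕ => (k : ℝ) / n) with hA
  set c : ℝ → ℝ := fun a => (discretisedMeasure σ n {a}).toReal with hc
  set s := A.filter (fun a => 0 < c a) with hsdef
  have hc0 : ∀ a, 0 ≤ c a := fun a => ENNReal.toReal_nonneg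
  -- the discretised measure as a positive combination of Dirac masses on `s`
  have hσ : discretisedMeasure σ n = ∑ l ∈ s, ENNReal.ofReal (c l) • Measure.dirac l := by
    rw [discretisedMeasure_eq_sum_dirac hn σ]
    have h1 : ∀ a, discretisedMeasure σ n {a} • Measure.dirac a =
        ENNReal.ofReal (c a) • Measure.dirac a := fun a => by
      rw [hc, ENNReal.ofReal_toReal (measure_ne_top _ _)]
    simp_rw [h1]
    rw [← Finset.sum_filter_add_sum_filter_not A (fun a => 0 < c a)]
    have hzero :
        ∑ a ∈ A.filter (fun a => ¬ 0 < c a), ENNReal.ofReal (c a) • Measure.dirac a = 0 := by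
      refine Finset.sum_eq_zero (fun a ha => ?_)
      rw [Finset.mem_filter] at ha
      have : c a = 0 := le_antisymm (not_lt.1 ha.2) (hc0 a)
      rw [this, ENNReal.ofReal_zero, zero_smul]
    rw [hzero, add_zero]
  have hd' : HasStieltjesRepresentation
      (fun z => (b : ℂ) + ∫ t : ℝ, ((t : ℂ) - z)⁻¹ ∂(discretisedMeasure σ n)) b
      (∑ l ∈ s, ENNReal.ofReal (c l) • Measure.dirac l) := by
    rw [← hσ]; exact hd
  have hs0 : ∀ l ∈ s, 0 ≤ l := by
    intro l hl
    rw [hsdef, Finset.mem_filter, hA, Finset.mem_image] at hl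
    obtain ⟨⟨k, -, rfl⟩, -⟩ := hl
    positivity
  have hcs : ∀ l ∈ s, 0 < c l := fun l hl => (Finset.mem_filter.1 hl).2
  exact KreinString.exists_string_of_finitelyAtomic hs0 hcs hd' hne

/-! ### Step 3–4: the limit string -/

/-- `tan` is non-decreasing on `[0, π/2)` and non-negative there. [folklore] -/
lemma tan_mono_of_mem {θ θ' : ℝ} (hθ : 0 ≤ θ) (hθθ' : θ ≤ θ') (hθ' : θ' < Real.pi / 2) :
    0 ≤ Real.tan θ ∧ Real.tan θ ≤ Real.tan θ' := by
  have hpi := Real.pi_pos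
  have hmono := Real.strictMonoOn_tan.monotoneOn
  have h0 : (0 : ℝ) ∈ Ioo (-(Real.pi / 2)) (Real.pi / 2) := ⟨by linarith, by linarith⟩
  have h1 : θ ∈ Ioo (-(Real.pi / 2)) (Real.pi / 2) := ⟨by linarith, lt_of_le_of_lt hθθ' hθ'⟩
  have h2 : θ' ∈ Ioo (-(Real.pi / 2)) (Real.pi / 2) := ⟨by linarith, hθ'⟩
  refine ⟨?_, hmono h1 h2 hθθ'⟩
  have := hmono h0 h1 hθ
  rwa [Real.tan_zero] at this

/-- **Kreĭn's inverse spectral theorem, existence part** (conjunct (iii) of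
`KreinInverseSpectralTheorem`): every `q ∈ N_S` which does not vanish identically off `[0, ∞)`
is the principal Titchmarsh–Weyl function of a Kreĭn string other than the free half-line.
[cite: KacKrein1974, §11] -/
theorem krein_existence {q : ℂ → ℂ} (hq : IsNevanlinnaStieltjes q)
    (hne : ∃ z ∈ offNonnegAxis, q z ≠ 0) :
    ∃ S : KreinString, ¬ S.IsTrivial ∧ EqOn S.principalWeylFunction q offNonnegAxis := by
  classical
  obtain ⟨b, σ, h⟩ := hq
  -- Step 1: rational approximants `q_n → q`
  set qn : ℕ → ℂ → ℂ := fun n z => (b : ℂ) + ∫ t : ℝ, ((t : ℂ) - z)⁻¹ ∂(discretisedMeasure σ n)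
    with hqn
  have hqn_t : ∀ z ∈ offNonnegAxis, Tendsto (fun n => qn n z) atTop (𝓝 (q z)) := fun z hz =>
    tendsto_discretised_stieltjes h hz
  -- `q(-1) > 0`, hence `q_n(-1) ≠ 0` eventually
  have hm1 : (-(1 : ℂ)) ∈ offNonnegAxis := Or.inr (by simp)
  have hq1 := re_apply_neg_pos_of_hasStieltjesRepresentation h hne one_pos
  simp only [Complex.ofReal_one] at hq1
  have hev : ∀ᶠ n in atTop, 0 < n ∧ qn n (-1) ≠ 0 := by
    have h1 : ∀ᶠ n in atTop, 0 < (qn n (-1)).re :=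
      ((Complex.continuous_re.tendsto _).comp (hqn_t _ hm1)).eventually (Ioi_mem_nhds hq1.1)
    filter_upwards [h1, eventually_gt_atTop 0] with n hn hn0
    exact ⟨hn0, fun h0 => by rw [h0, Complex.zero_re] at hn; exact lt_irrefl _ hn⟩
  obtain ⟨n₀, hn₀⟩ := eventually_atTop.1 hev
  -- Step 2: strings `T k` with `q_{T k} = q_{n₀ + k}`
  have hT : ∀ k : ℕ, ∃ T : KreinString, ¬ T.IsTrivial ∧
      EqOn T.principalWeylFunction (qn (n₀ + k)) offNonnegAxis := fun k =>
    exists_string_of_discretised h (hn₀ _ (Nat.le_add_right _ _)).1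
      ⟨-1, hm1, (hn₀ _ (Nat.le_add_right _ _)).2⟩
  choose T hTnt hTq using hT
  -- Step 3: a subsequence with convergent mass profiles
  obtain ⟨φ, hφ, G, hGm, hGb, hGfin, hGinf⟩ := exists_subseq_mass_tendsto T
  set T' : ℕ → KreinString := fun k => T (φ k) with hT'
  have hT'nt : ∀ k, ¬ (T' k).IsTrivial := fun k => hTnt (φ k)
  -- the values `q_{T' k}(-s) → q(-s)` for `s > 0`
  have hlim : ∀ s : ℝ, 0 < s →
      Tendsto (fun k => ((T' k).principalWeylFunction (-(s : ℂ))).re) atTop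
        (𝓝 (q (-(s : ℂ))).re) := by
    intro s hs
    have hz : (-(s : ℂ)) ∈ offNonnegAxis := Or.inr (by simpa using hs)
    have h1 : Tendsto (fun k => qn (n₀ + φ k) (-(s : ℂ))) atTop (𝓝 (q (-(s : ℂ)))) :=
      (hqn_t _ hz).comp (tendsto_atTop_mono (fun k => Nat.le_add_left (φ k) n₀) hφ.tendsto_atTop)
    refine ((Complex.continuous_re.tendsto _).comp h1).congr (fun k => ?_)
    simp only [Function.comp_apply, hT']
    rw [hTq (φ k) hz]
  have hux : ∀ x : ℝ, 0 ≤ x → x / (1 + x) ∈ Icc (0 : ℝ) 1 := fun x hx =>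
    ⟨div_nonneg hx (by linarith), (div_le_one (by linarith)).2 (by linarith)⟩
  -- Case D1: the masses explode at every `x > 0` — impossible (`q_{T'}(-1) → 0`)
  by_cases hD1 : ∀ x : ℝ, 0 < x → G (x / (1 + x)) = Real.pi / 2
  · exfalso
    have h0 := tendsto_weyl_neg_zero_of_explode T' hT'nt one_pos
      (fun x hx K => hGinf x hx.le (hD1 x hx) K)
    have h1 := hlim 1 one_pos
    simp only [Complex.ofReal_one] at h0 h1
    have := tendsto_nhds_unique h0 h1
    linarith [hq1.1]
  push Not at hD1
  obtain ⟨x₀, hx₀, hGx₀⟩ := hD1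
  have hGx₀' : G (x₀ / (1 + x₀)) < Real.pi / 2 := lt_of_le_of_ne (hGb _ (hux x₀ hx₀.le)).2 hGx₀
  -- the limit length `ℓ = sup {x : G(x/(1+x)) < π/2}` and profile `g = tan G`
  set ℓ : ℝ≥0∞ := ⨆ (x : ℝ) (_ : 0 ≤ x ∧ G (x / (1 + x)) < Real.pi / 2), ENNReal.ofReal x with hℓ
  have hℓpos : 0 < ℓ :=
    lt_of_lt_of_le (ENNReal.ofReal_pos.2 hx₀) (le_iSup₂ (f := fun (x : ℝ) (_ : 0 ≤ x ∧
      G (x / (1 + x)) < Real.pi / 2) => ENNReal.ofReal x) x₀ ⟨hx₀.le, hGx₀'⟩)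
  have hDℓ : ∀ y : ℝ, y ∈ KreinString.OfProfile.D ℓ ↔
      0 ≤ y ∧ ∃ x : ℝ, 0 ≤ x ∧ G (x / (1 + x)) < Real.pi / 2 ∧ y < x := by
    intro y
    constructor
    · rintro ⟨hy0, hy⟩
      rw [hℓ, lt_iSup_iff] at hy
      obtain ⟨x, hx⟩ := hy
      rw [lt_iSup_iff] at hx
      obtain ⟨hxc, hyx⟩ := hx
      exact ⟨hy0, x, hxc.1, hxc.2, (ENNReal.ofReal_lt_ofReal_iff_of_nonneg hy0).1 hyx⟩
    · rintro ⟨hy0, x, hx0, hGx, hyx⟩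
      refine ⟨hy0, lt_of_lt_of_le ((ENNReal.ofReal_lt_ofReal_iff_of_nonneg hy0).2 hyx) ?_⟩
      exact le_iSup₂ (f := fun (x : ℝ) (_ : 0 ≤ x ∧ G (x / (1 + x)) < Real.pi / 2) =>
        ENNReal.ofReal x) x ⟨hx0, hGx⟩
  -- on `[0, ℓ)` the limit profile is finite
  have hGlt : ∀ y ∈ KreinString.OfProfile.D ℓ, G (y / (1 + y)) < Real.pi / 2 := by
    intro y hy
    obtain ⟨hy0, x, hx0, hGx, hyx⟩ := (hDℓ y).1 hy
    refine lt_of_le_of_lt (hGm (hux y hy0) (hux x hx0) ?_) hGx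
    rw [div_le_div_iff₀ (by linarith) (by linarith)]; nlinarith
  -- beyond `ℓ` it is `π/2`
  have hGge : ∀ x : ℝ, ℓ < ENNReal.ofReal x → G (x / (1 + x)) = Real.pi / 2 := by
    intro x hx
    have hx0 : 0 < x := ENNReal.ofReal_pos.1 (hℓpos.trans hx)
    by_contra hne'
    have hlt : G (x / (1 + x)) < Real.pi / 2 := lt_of_le_of_ne (hGb _ (hux x hx0.le)).2 hne'
    have : ENNReal.ofReal x ≤ ℓ := le_iSup₂ (f := fun (x : ℝ) (_ : 0 ≤ x ∧
      G (x / (1 + x)) < Real.pi / 2) => ENNReal.ofReal x) x ⟨hx0.le, hlt⟩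
    exact absurd hx (not_lt.2 this)
  set g : ℝ → ℝ := fun y => max 0 (Real.tan (G (y / (1 + y)))) with hg
  have hg0 : ∀ y, 0 ≤ g y := fun y => le_max_left _ _
  have hgD : ∀ y ∈ KreinString.OfProfile.D ℓ, g y = Real.tan (G (y / (1 + y))) := fun y hy =>
    max_eq_right (tan_mono_of_mem (hGb _ (hux y hy.1)).1 le_rfl (hGlt y hy)).1
  have hgm : MonotoneOn g (KreinString.OfProfile.D ℓ) := by
    intro y hy y' hy' hyy'
    rw [hgD y hy, hgD y' hy']
    refine (tan_mono_of_mem (hGb _ (hux y hy.1)).1 (hGm (hux y hy.1) (hux y' hy'.1) ?_)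
      (hGlt y' hy')).2
    rw [div_le_div_iff₀ (by linarith [hy.1]) (by linarith [hy'.1])]; nlinarith [hy.1]
  -- convergence of the masses on `[0, ℓ)`
  have hmconv : ∀ y ∈ KreinString.OfProfile.D ℓ, (∀ᶠ k in atTop, y ∈ (T' k).dom) ∧
      Tendsto (fun k => (T' k).mass y) atTop (𝓝 (g y)) := by
    intro y hy
    obtain ⟨h1, h2⟩ := hGfin y hy.1 (hGlt y hy)
    rw [hgD y hy]
    exact ⟨h1, h2⟩
  -- Case D2a: `ℓ = ∞` and no mass at all — impossible (`q_{T'}(-1) → ∞`)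
  by_cases hD2a : ℓ = ⊤ ∧ ∀ y ∈ KreinString.OfProfile.D ℓ, g y = 0
  · exfalso
    have hall : ∀ x : ℝ, 0 ≤ x → x ∈ KreinString.OfProfile.D ℓ := fun x hx => ⟨hx, by simp [hD2a.1]⟩
    have h0 := tendsto_weyl_neg_atTop_of_vanish T' hT'nt one_pos (fun x hx => by
      obtain ⟨h1, h2⟩ := hmconv x (hall x hx)
      rw [hD2a.2 x (hall x hx)] at h2
      exact ⟨h1, h2⟩)
    have h1 := hlim 1 one_pos
    simp only [Complex.ofReal_one] at h0 h1
    exact not_tendsto_atTop_of_tendsto_nhds h1 h0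
  -- Case D2b: the limit string
  set S := KreinString.ofProfile ℓ hℓpos g hg0 hgm with hS
  have hSnt : ¬ S.IsTrivial := by
    rintro ⟨hL, hm⟩
    apply hD2a
    refine ⟨hL, fun y hy => le_antisymm ?_ (hg0 y)⟩
    have h1 : g y ≤ S.mass y := KreinString.le_mass_ofProfile hℓpos hg0 hgm hy
    have h2 : S.mass y = 0 := by
      rw [KreinString.mass_def, hm, Measure.coe_zero, Pi.zero_apply, ENNReal.toReal_zero]
    linarith
  -- hypotheses of the continuity theorem
  have hDinit : ∀ {y x' : ℝ}, 0 ≤ y → y ≤ x' → x' ∈ KreinString.OfProfile.D ℓ →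
      y ∈ KreinString.OfProfile.D ℓ := fun hy hyx hx' =>
    ⟨hy, lt_of_le_of_lt (ENNReal.ofReal_le_ofReal hyx) hx'.2⟩
  have hconv : ∀ᵐ x : ℝ, x ∈ S.dom → ((∀ᶠ k in atTop, x ∈ (T' k).dom) ∧
      Tendsto (fun k => (T' k).mass x) atTop (𝓝 (S.mass x))) := by
    have hnull : volume {x ∈ KreinString.OfProfile.D ℓ |
        ¬ContinuousWithinAt g (KreinString.OfProfile.D ℓ ∩ Ioi x) x} = 0 :=
      (hgm.countable_not_continuousWithinAt_Ioi).measure_zero volume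
    rw [ae_iff]
    refine measure_mono_null (fun x hx => ?_) hnull
    simp only [mem_setOf_eq, Classical.not_imp] at hx
    obtain ⟨hxD, hnot⟩ := hx
    refine ⟨hxD, fun hcont => hnot ?_⟩
    -- `D ∩ (x, ∞)` is a right-neighbourhood of `x`
    obtain ⟨k, hk⟩ := KreinString.OfProfile.exists_lt_xs hxD
    have hmem : KreinString.OfProfile.D ℓ ∩ Ioi x ∈ 𝓝[>] x := by
      refine mem_of_superset (Ioo_mem_nhdsGT hk) (fun y hy => ⟨?_, hy.1⟩)
      exact hDinit (hxD.1.trans hy.1.le) hy.2.le (KreinString.OfProfile.xs_mem hℓpos k)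
    have hmx : S.mass x = g x :=
      KreinString.mass_ofProfile_eq_of_continuousWithinAt hℓpos hg0 hgm hxD
        (hcont.mono_of_mem_nhdsWithin hmem)
    rw [hmx]
    exact hmconv x hxD
  have hexpl : ∀ x : ℝ, S.length < ENNReal.ofReal x → ∀ K : ℝ,
      ∀ᶠ k in atTop, x ∉ (T' k).dom ∨ K ≤ (T' k).mass x := by
    intro x hx K
    have hx0 : 0 < x := ENNReal.ofReal_pos.1 (hℓpos.trans hx)
    exact hGinf x hx0.le (hGge x hx) K
  have hE4 : ∀ s : ℝ, 0 < s → Tendsto (fun k => ((T' k).principalWeylFunction (-(s : ℂ))).re) atTop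
      (𝓝 (S.principalWeylFunction (-(s : ℂ))).re) := fun s hs =>
    KreinString.tendsto_weyl_neg_of_mass_tendsto hSnt hT'nt hs hconv hexpl
  -- equality on the negative axis, then everywhere off `[0, ∞)`
  have hneg : ∀ s : ℝ, 0 < s → S.principalWeylFunction (-(s : ℂ)) = q (-(s : ℂ)) := by
    intro s hs
    have h1 := tendsto_nhds_unique (hE4 s hs) (hlim s hs)
    obtain ⟨-, -, hSim⟩ := S.tendsto_principalWeylFunction_of_neg hSnt (z := -(s : ℂ)) (by simp)
      (by simpa using hs)
    have hq' := re_apply_neg_pos_of_hasStieltjesRepresentation h hne hs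
    exact Complex.ext h1 (by rw [hSim, hq'.2])
  exact ⟨S, hSnt, eqOn_offNonnegAxis_of_eqOn_neg (S.differentiableOn_principalWeylFunction hSnt)
    h.differentiableOn hneg⟩

/-- **Conjunct (iii) of `KreinInverseSpectralTheorem`, verbatim.** [cite: KacKrein1974, §11] -/
theorem krein_theorem_part_three :
    ∀ q : ℂ → ℂ, IsNevanlinnaStieltjes q → (∃ z ∈ offNonnegAxis, q z ≠ 0) →
      ∃ S : KreinString, ¬ S.IsTrivial ∧ Set.EqOn S.principalWeylFunction q offNonnegAxis :=
  fun _ hq hne => krein_existence hq hne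

/-- **Kreĭn's theorem reduced to its uniqueness part**: conjuncts (i) (`krein_theorem_part_one`)
and (iii) (`krein_theorem_part_three`) being theorems, `KreinInverseSpectralTheorem` follows from
the uniqueness statement (ii) alone (Kreĭn's uniqueness theorem; de Branges' ordering theorem).
[cite: KacKrein1974, §11] -/
theorem kreinInverseSpectralTheorem_of_uniqueness
    (h₂ : ∀ S₁ S₂ : KreinString, ¬ S₁.IsTrivial → ¬ S₂.IsTrivial →
      Set.EqOn S₁.principalWeylFunction S₂.principalWeylFunction offNonnegAxis → S₁ = S₂) :
    KreinInverseSpectralTheorem :=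
  ⟨krein_theorem_part_one, h₂, krein_theorem_part_three⟩

end Literature.Analysis.InverseSpectral

end
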